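import Literature.Computability.AlgebraicComplexity.MatMulOccurrenceObstructions
import Literature.Computability.AlgebraicComplexity.IsotypicOccurrenceSemigroup
import Literature.Computability.AlgebraicComplexity.PlethysmStability
import HarnessLib

/-!
# The vanishing half of Bürgisser–Ikenmeyer's occurrence obstruction `λ(κ)` (STOC 2013, Rem. 4.7 with Prop. 4.2 and Thm. 4.1), proved

Topic `Literature/Computability/AlgebraicComplexity` (geometric complexity theory, tensor setting);
proofs file (theorems only: no definitions, no named facts) for the typed-chain file
`MatMulOccurrenceObstructions.lean` of the cell `pub-gct-max` (track T, seat lit-2), whose NAMED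
fact `burgisserIkenmeyer2013_rem_4_7` records P. Bürgisser, C. Ikenmeyer, *Explicit lower bounds
via geometric complexity theory*, STOC 2013 = arXiv:1210.8368 [BurgisserIkenmeyer2013], Rem. 4.7:
for odd `m ≥ 3`, `2κ + 1 = m²`, `n = 3κ`, `d = 3κ + 1` and `λ(κ) = (hook, hook, hook)`,
`hook = (κ+1, 1^{2κ}) ⊢ 3κ+1` (`bi2013Hook κ`),
(i) type `λ(κ)` does NOT occur in degree `d` of `𝒪(closure(GL³·⟨n⟩))` and
(ii) it DOES occur in degree `d` of `𝒪(closure(GL³·⟨m,m,m⟩))`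
(occurrence = non-vanishing of the triple isotypic character sum on the `d`-th tensor power, as in
`IsotypicPressure.lean` / `UnitTensorMomentPolytope.lean`). Honest framing of the cell: a
kernel-checked half of one printed occurrence obstruction in the TENSOR setting; multiplicity data
and certified rank bounds at small parameters; occurrence obstructions are ruled out in print for
determinant versus padded permanent (BIP 2019) — nothing here is a claim on VP vs VNP or P vs NP.

## What is printed

* Thm. 4.1: the polynomials `f_H` of the obstruction designs `H` of type `λ` are highest weight
  vectors of weight `λ*` and SPAN `HWV_{λ*}(Sym^d ⊗³(ℂ*)^n)`.
* Prop. 4.2: "Let `H` be an obstruction design of type `λ ⊢*_n d`. Then we have `f_H(w) = 0` for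
  all tensors `w ∈ ⊗³ℂ^n` satisfying `R̲(w) < χ'(H)`." Proof: for `w = ∑_{i=1}^r w_i^{(1)} ⊗
  w_i^{(2)} ⊗ w_i^{(3)}`, `f_H(w) = ∑_{J : H → T} eval_H(J)` ((4.2)); "If `r = |T| < χ'(H)`, then a
  map `J : H → T` cannot be a proper coloring of `H`. Hence there exists some `k` and some slice
  `e ∈ E^{(k)}` in which two points get the same color. As a consequence, the matrix `J^{(k)}|e`
  has a duplicated column and hence `det J^{(k)}|e = 0`."
* §4.4: `H_κ := {(i,j,k) ∈ [κ+1]³ | i = 1 or j = 1 or k = 1}`, of type `λ(κ)`; "It is obvious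
  that `χ'(H_κ) = 3κ+1`."
* Rem. 4.7: "One can prove that `H_κ` is the only obstruction design of type `λ(κ)`. Put
  `n := 3κ` and `d := 3κ+1`. Proposition 4.2 implies that `f_{H_κ}` vanishes on
  `closure(GL_n³ E_n)`. Therefore, `mult_{λ(κ)}(ℂ[closure(GL_n³ E_n)]_d) = 0`. Hence `λ(κ)` is an
  occurence obstruction against `MaMu_m ∈ closure(GL_n³ E_n)`."

## What is proved here (kernel; every `κ ≥ 1`, no parity hypothesis)

`isotypicSum_bi2013Hook_kroneckerPow_unitTensor_eq_zero`: conjunct (i), i.e.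
`isotypicSum₁ hook (isotypicSum₂ hook (isotypicSum₃ hook (⟨3κ⟩^{⊗(3κ+1)}))) = 0`, and the
reduction `burgisserIkenmeyer2013_rem_4_7_of_lemma_4_4`: the named fact now follows from (and, by
`lemma_4_4_of_burgisserIkenmeyer2013_rem_4_7`, is equivalent to) its matrix-multiplication half
= Lemma 4.4 ("There exists a matrix triple `A ∈ (GL_{m²})³` such that `f_{H_κ}(A MaMu_m) ≠ 0`"),
which is NOT proved here (§6 of the paper, "the technically most involved part of this paper").

## The printed proof and the road taken here

The printed argument for (i) has three inputs: Thm. 4.1 (the `f_H` span the highest-weight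
vectors), the uniqueness of the design of type `λ(κ)` ("one can prove"), and Prop. 4.2 with
`χ'(H_κ) = 3κ + 1 > n`. In the tree's coordinates (word models `wordRep ℂ N d` of `(ℂ^N)^{⊗d}`,
`TensorWordModel.lean`; highest-weight spaces `highestWeightSpace`, `GLHighestWeight.lean`):

1. Occurrence ⇒ pairing (tree, `IsotypicOccurrenceSemigroup.lean`,
   `exists_pairing_ne_zero_of_isotypicSum₁₂₃_kroneckerPow_ne_zero`): if the type occurred, some
   restriction `(A ⊗ B ⊗ C)·⟨n⟩` and some triple of highest-weight vectors `ξ₁, ξ₂, ξ₃` of weight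
   `hook` in the three word models would pair non-trivially:
   `⟪((A⊗B⊗C)·⟨n⟩)^{⊗d}, ξ₁ ⊗ ξ₂ ⊗ ξ₃⟫ ≠ 0`.
2. Thm. 4.1, one factor at a time = BIP 2019 Prop. 3.3 in basis form (tree,
   `PlethysmStability.lean`, `exists_sum_smul_polytabloid_eq`): each `ξ_j` is a combination of the
   polytabloids `e_T` of the standard tableaux `T` of hook shape; so it suffices that every
   `⟪((A⊗B⊗C)·⟨n⟩)^{⊗d}, e_{T₁} ⊗ e_{T₂} ⊗ e_{T₃}⟫` vanishes (§5).
3. (4.2) (§1): `(A⊗B⊗C)·⟨n⟩ = ∑_{s<n} a_s ⊗ b_s ⊗ c_s` (columns), and the pairing is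
   `∑_{I : [d] → [n]} ⟨⊗_m a_{I m}, e_{T₁}⟩ ⟨⊗_m b_{I m}, e_{T₂}⟩ ⟨⊗_m c_{I m}, e_{T₃}⟩` — the maps
   `I` are BI's triple labelings `J`, the three factors the `eval_{E^{(k)}}(J^{(k)})`.
4. ONE antisymmetry lemma (§2, from the tree's `wordPerm_polytabloid_of_mem_colStab`, BIP (3.5)):
   exchanging the labels of two entries `p ≠ q` of one column of `T` changes the sign of
   `⟨⊗_m x_{I m}, e_T⟩`. It gives BOTH printed mechanisms (§3): (a) "duplicated column ⇒
   `det = 0`": if `I p = I q` for `p, q` in one column of `T_j`, the `j`-th factor vanishes;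
   (b) if some `p ≠ q` share a column in ALL three tableaux, the whole sum equals `(-1)³` times
   itself (reindex `I ↦ I ∘ (p q)`) — this is why only genuine obstruction designs (injective
   position maps) matter in Thm. 4.1.
5. Uniqueness of `H_κ` (§4), PROVED as a counting lemma: if three hook tableaux on the same
   `3κ + 1` positions put no two positions in a common column of all three, then every two
   positions share the FIRST column of one of them (`share_column_of_design`; first columns have
   `≥ 2κ + 1` entries, columns are `< κ + 1`, complements `≤ κ`, so the complement of one first
   column lies inside the other two). Hence in case (a)'s complement every `I : [d] → [n]`,
   `d = n + 1`, identifies two positions of one column (pigeonhole) — Prop. 4.2 with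
   `χ'(H_κ) = d > n`.

## References

* [BurgisserIkenmeyer2013] P. Bürgisser, C. Ikenmeyer, *Explicit lower bounds via geometric
  complexity theory*, STOC 2013, 141–150 = arXiv:1210.8368, §4.2 (Thm. 4.1, (4.2)), §4.3
  (Prop. 4.2), §4.4 (`H_κ`, Lemma 4.4, Thm. 4.5, Rem. 4.7).
* [BurgisserIkenmeyerPanovaJAMS2019] P. Bürgisser, C. Ikenmeyer, G. Panova, *No occurrence
  obstructions in geometric complexity theory*, J. Amer. Math. Soc. 32 (2019), Prop. 3.3 and (3.5)
  (highest-weight vectors of `⊗^d V` are spanned by the `S_d`-orbit of `v_λ`; column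
  transpositions act by `-1`).
* [BurgisserIkenmeyer2011] P. Bürgisser, C. Ikenmeyer, *Geometric complexity theory and tensor
  rank*, STOC 2011 = arXiv:1011.1350, Def. 3.1 and (3.1) (semigroup of representations,
  obstructions), §4 (highest-weight vectors by column determinants).

## Tree

`MatMulOccurrenceObstructions` (`bi2013Hook`, `burgisserIkenmeyer2013_rem_4_7`),
`IsotypicOccurrenceSemigroup` (`exists_pairing_ne_zero_of_isotypicSum₁₂₃_kroneckerPow_ne_zero`),
`PlethysmStability` (`exists_sum_smul_polytabloid_eq`,
`StdFilling.wordPerm_polytabloid_of_mem_colStab`), `SchurWeylPlethysmHwMultiplicityProofs`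
(`StdFilling`, `polytabloid`, `ydWeight_youngDiagram`, `fst_lt_of_mem_youngDiagram`,
`swap_mem_colStab`), `PartitionTableaux` (`Nat.Partition.youngDiagram`, `sortedParts`,
`card_cells_youngDiagram`), `AsymptoticSpectrum` (`unitTensor`, `kroneckerPow`),
`QuantumFunctionals` (`actTensor`), `MatrixMultiplicationExponent` (`triad`, `matMulTensor`).
Mathlib: `Finset.prod_univ_sum`, `Fintype.sum_equiv`, `Equiv.prod_comp`,
`Fintype.exists_ne_map_eq_of_card_lt`, `Finset.card_le_card_of_injOn`, `List.Perm.eq_of_sortedGE`.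
-/

noncomputable section

open scoped BigOperators

namespace Literature.Computability.AlgebraicComplexity

open Literature.NumberTheory.DiophantineGeometry (Word wordRep wordPerm wordPerm_apply
  highestWeightSpace Weight StdFilling ydWeight ydWeight_youngDiagram fst_lt_of_mem_youngDiagram)

/-! ## §1 Restrictions of the unit tensor and their tensor powers -/

section UnitTensor

variable {n d : ℕ}

/-- A restriction `(A ⊗ B ⊗ C)·⟨n⟩` of the unit tensor is the sum of the `n` triads of columns
`∑_s a_s ⊗ b_s ⊗ c_s` (a tensor of rank `≤ n`): entrywise
`((A ⊗ B ⊗ C)·⟨n⟩)_{ijl} = ∑_s A_{is} B_{js} C_{ls}`.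
[cite: BurgisserIkenmeyer2013, §2.1 (after (2.1): "R̲(w) ≤ n iff w ∈ closure(G E_n)")] -/
theorem actTensor_unitTensor_apply (A B C : Matrix (Fin n) (Fin n) ℂ) (i j l : Fin n) :
    actTensor A B C (unitTensor ℂ n) i j l = ∑ s, A i s * B j s * C l s := by
  rw [actTensor_apply]
  refine Finset.sum_congr rfl fun s _ => ?_
  rw [Finset.sum_eq_single s]
  · rw [Finset.sum_eq_single s]
    · simp
    · intro c _ hc
      simp [Ne.symm hc]
    · simp
  · intro b _ hb
    refine Finset.sum_eq_zero fun c _ => ?_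
    simp [Ne.symm hb]
  · simp

/-- The `d`-th tensor power of a restriction of the unit tensor, expanded over the maps
`I : [d] → [n]` choosing one of the `n` rank-one summands at every position:
`((A⊗B⊗C)·⟨n⟩)^{⊗d}(u,v,w) = ∑_I ∏_m A_{u_m, I m} B_{v_m, I m} C_{w_m, I m}` (BI 2013, proof of
(4.2): "`w^{⊗d} = ∑_{I : [d] → [r]} ⊗_s ⊗_k w^{(k)}_{I(s)}`").
[cite: BurgisserIkenmeyer2013, §4.2 (display before (4.2))] -/
theorem kroneckerPow_actTensor_unitTensor_apply (A B C : Matrix (Fin n) (Fin n) ℂ)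
    (u v w : Word n d) :
    kroneckerPow (actTensor A B C (unitTensor ℂ n)) d u v w =
      ∑ I : Fin d → Fin n, ∏ m, (A (u m) (I m) * B (v m) (I m) * C (w m) (I m)) := by
  simp only [kroneckerPow_apply, actTensor_unitTensor_apply]
  rw [Finset.prod_univ_sum (fun _ => (Finset.univ : Finset (Fin n)))
    (fun m s => A (u m) s * B (v m) s * C (w m) s), Fintype.piFinset_univ]

/-- Four finite sums commute: the outer index moves inside three others. [folklore] -/
private theorem sum_comm₄ {α β γ δ M : Type*} [Fintype α] [Fintype β] [Fintype γ] [Fintype δ]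
    [AddCommMonoid M] (f : α → β → γ → δ → M) :
    ∑ i, ∑ x, ∑ y, ∑ z, f i x y z = ∑ x, ∑ y, ∑ z, ∑ i, f i x y z := by
  rw [Finset.sum_comm]
  refine Finset.sum_congr rfl fun x _ => ?_
  rw [Finset.sum_comm]
  refine Finset.sum_congr rfl fun y _ => ?_
  exact Finset.sum_comm

/-- **The pairing with a power of a rank-`≤ n` tensor, expanded** (BI 2013, (4.2):
"`f_H(w) = ∑_{J : H → T} eval_H(J)`"): for any functions `ξ₁, ξ₂, ξ₃` on words,
`⟪((A⊗B⊗C)·⟨n⟩)^{⊗d}, ξ₁ ⊗ ξ₂ ⊗ ξ₃⟫ = ∑_{I : [d] → [n]} ⟨⊗_m a_{I m}, ξ₁⟩ ⟨⊗_m b_{I m}, ξ₂⟩ ⟨⊗_m c_{I m}, ξ₃⟩`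
with `⟨⊗_m a_{I m}, ξ⟩ = ∑_u (∏_m A_{u_m, I m}) ξ(u)`.
[cite: BurgisserIkenmeyer2013, §4.2 (4.2)] -/
theorem pairing_unitTensor_eq_sum (A B C : Matrix (Fin n) (Fin n) ℂ)
    (ξ₁ ξ₂ ξ₃ : Word n d → ℂ) :
    ∑ u, ∑ v, ∑ w, kroneckerPow (actTensor A B C (unitTensor ℂ n)) d u v w * triad ξ₁ ξ₂ ξ₃ u v w =
      ∑ I : Fin d → Fin n, (∑ u : Word n d, (∏ m, A (u m) (I m)) * ξ₁ u) *
        (∑ v : Word n d, (∏ m, B (v m) (I m)) * ξ₂ v) *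
        (∑ w : Word n d, (∏ m, C (w m) (I m)) * ξ₃ w) := by
  symm
  calc ∑ I : Fin d → Fin n, (∑ u : Word n d, (∏ m, A (u m) (I m)) * ξ₁ u) *
        (∑ v : Word n d, (∏ m, B (v m) (I m)) * ξ₂ v) *
        (∑ w : Word n d, (∏ m, C (w m) (I m)) * ξ₃ w)
      = ∑ I : Fin d → Fin n, ∑ u : Word n d, ∑ v : Word n d, ∑ w : Word n d,
          (∏ m, A (u m) (I m)) * ξ₁ u * ((∏ m, B (v m) (I m)) * ξ₂ v) *
            ((∏ m, C (w m) (I m)) * ξ₃ w) := by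
        refine Finset.sum_congr rfl fun I _ => ?_
        rw [Finset.sum_mul_sum, Finset.sum_mul]
        refine Finset.sum_congr rfl fun u _ => ?_
        rw [Finset.sum_mul]
        refine Finset.sum_congr rfl fun v _ => ?_
        rw [Finset.mul_sum]
    _ = ∑ u : Word n d, ∑ v : Word n d, ∑ w : Word n d, ∑ I : Fin d → Fin n,
          (∏ m, A (u m) (I m)) * ξ₁ u * ((∏ m, B (v m) (I m)) * ξ₂ v) *
            ((∏ m, C (w m) (I m)) * ξ₃ w) := sum_comm₄ _
    _ = _ := by
        refine Finset.sum_congr rfl fun u _ => Finset.sum_congr rfl fun v _ =>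
          Finset.sum_congr rfl fun w _ => ?_
        rw [kroneckerPow_actTensor_unitTensor_apply, triad_apply, Finset.sum_mul]
        refine Finset.sum_congr rfl fun I _ => ?_
        rw [Finset.prod_mul_distrib, Finset.prod_mul_distrib]
        ring

end UnitTensor

/-! ## §2 Column alternation: one antisymmetry lemma and its two uses (BI 2013, proof of Prop. 4.2) -/

section Antisymmetry

variable {n d : ℕ} {Y : YoungDiagram}

/-- **Column antisymmetry of the elementary pairings.** For a standard tableau `T` and two
distinct entries `p ≠ q` of one column of `T`, the pairing `⟨⊗_m x_{I m}, e_T⟩` of the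
polytabloid `e_T` with a decomposable word tensor changes sign when the labels of `p` and `q` are
exchanged: `⟨⊗_m x_{I((p q) m)}, e_T⟩ = -⟨⊗_m x_{I m}, e_T⟩` — the transposition `(p q) ∈ C_T`
acts on `e_T` by `-1` (BIP (3.5), tree `wordPerm_polytabloid_of_mem_colStab`). This is the
mechanism of BI 2013 Prop. 4.2: "the matrix `J^{(k)}|e` has a duplicated column and hence
`det J^{(k)}|e = 0`". [cite: BurgisserIkenmeyer2013, Prop. 4.2 (proof)] -/
theorem sum_prod_mul_polytabloid_comp_swap (hN : ∀ x ∈ Y.cells, x.1 < n) (T : StdFilling d Y)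
    {p q : Fin d} (hpq : p ≠ q) (hcol : (T.1 p).2 = (T.1 q).2) (M : Matrix (Fin n) (Fin n) ℂ)
    (I : Fin d → Fin n) :
    ∑ u : Word n d, (∏ m, M (u m) (I (Equiv.swap p q m))) * T.polytabloid ℂ hN u =
      -∑ u : Word n d, (∏ m, M (u m) (I m)) * T.polytabloid ℂ hN u := by
  set τ : Equiv.Perm (Fin d) := Equiv.swap p q with hτ_def
  have hτ : τ ∈ T.colStab := StdFilling.swap_mem_colStab hcol
  have hanti : ∀ u : Word n d, T.polytabloid ℂ hN (u ∘ ⇑τ) = -T.polytabloid ℂ hN u := by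
    intro u
    have h := congrFun (StdFilling.wordPerm_polytabloid_of_mem_colStab (k := ℂ) hN T hτ) u
    rw [wordPerm_apply, hτ_def, Equiv.Perm.sign_swap hpq] at h
    rw [hτ_def, h]
    simp
  -- reindex the left-hand sum by `u ↦ u ∘ τ`
  have hre : ∑ u : Word n d, (∏ m, M (u m) (I (τ m))) * T.polytabloid ℂ hN u =
      ∑ u : Word n d, (∏ m, M ((u ∘ ⇑τ) m) (I (τ m))) * T.polytabloid ℂ hN (u ∘ ⇑τ) := by
    refine Fintype.sum_equiv (Equiv.arrowCongr τ (Equiv.refl (Fin n))) _ _ fun u => ?_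
    have hu : ((Equiv.arrowCongr τ (Equiv.refl (Fin n))) u) ∘ ⇑τ = u := by
      funext m
      simp [Equiv.arrowCongr_apply]
    rw [hu]
  rw [hre, ← Finset.sum_neg_distrib]
  refine Finset.sum_congr rfl fun u _ => ?_
  rw [hanti, mul_neg]
  congr 2
  exact Equiv.prod_comp τ (fun m => M (u m) (I m))

/-- First use (a repeated label in a column kills the term): if `I p = I q` for two distinct
entries `p ≠ q` of one column of `T`, then `⟨⊗_m x_{I m}, e_T⟩ = 0` ("`det J^{(k)}|e = 0`").
[cite: BurgisserIkenmeyer2013, Prop. 4.2 (proof)] -/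
theorem sum_prod_mul_polytabloid_eq_zero_of_apply_eq (hN : ∀ x ∈ Y.cells, x.1 < n)
    (T : StdFilling d Y) {p q : Fin d} (hpq : p ≠ q) (hcol : (T.1 p).2 = (T.1 q).2)
    (M : Matrix (Fin n) (Fin n) ℂ) {I : Fin d → Fin n} (hI : I p = I q) :
    ∑ u : Word n d, (∏ m, M (u m) (I m)) * T.polytabloid ℂ hN u = 0 := by
  have h := sum_prod_mul_polytabloid_comp_swap hN T hpq hcol M I
  have hfix : ∀ m, I (Equiv.swap p q m) = I m := fun m => Equiv.apply_swap_eq_self hI m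
  simp only [hfix] at h
  exact add_self_eq_zero.1 (by nth_rewrite 2 [h]; ring)

end Antisymmetry

/-! ## §3 Triples of tableaux: the two vanishing mechanisms -/

section Triples

variable {n d : ℕ} {Y₁ Y₂ Y₃ : YoungDiagram}

/-- **Non-designs die by symmetry.** If two distinct positions `p ≠ q` lie in one column of each
of the three standard tableaux `T₁, T₂, T₃`, then
`∑_I ⟨⊗ a_I, e_{T₁}⟩ ⟨⊗ b_I, e_{T₂}⟩ ⟨⊗ c_I, e_{T₃}⟩ = 0`: reindexing `I ↦ I ∘ (p q)` produces the
factor `(-1)³`. (In BI 2013's language: the symmetrisation of `e_{T₁} ⊗ e_{T₂} ⊗ e_{T₃}` is then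
not the `f_H` of an obstruction design — two points of `H` would coincide — and vanishes.)
[cite: BurgisserIkenmeyer2013, Thm. 4.1 and §4.2] -/
theorem tripleSum_eq_zero_of_common_column (hN₁ : ∀ x ∈ Y₁.cells, x.1 < n)
    (hN₂ : ∀ x ∈ Y₂.cells, x.1 < n) (hN₃ : ∀ x ∈ Y₃.cells, x.1 < n) (T₁ : StdFilling d Y₁)
    (T₂ : StdFilling d Y₂) (T₃ : StdFilling d Y₃) {p q : Fin d} (hpq : p ≠ q)
    (h₁ : (T₁.1 p).2 = (T₁.1 q).2) (h₂ : (T₂.1 p).2 = (T₂.1 q).2) (h₃ : (T₃.1 p).2 = (T₃.1 q).2)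
    (A B C : Matrix (Fin n) (Fin n) ℂ) :
    ∑ I : Fin d → Fin n, (∑ u : Word n d, (∏ m, A (u m) (I m)) * T₁.polytabloid ℂ hN₁ u) *
        (∑ v : Word n d, (∏ m, B (v m) (I m)) * T₂.polytabloid ℂ hN₂ v) *
        (∑ w : Word n d, (∏ m, C (w m) (I m)) * T₃.polytabloid ℂ hN₃ w) = 0 := by
  set τ : Equiv.Perm (Fin d) := Equiv.swap p q with hτ_def
  set S := ∑ I : Fin d → Fin n, (∑ u : Word n d, (∏ m, A (u m) (I m)) * T₁.polytabloid ℂ hN₁ u) *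
        (∑ v : Word n d, (∏ m, B (v m) (I m)) * T₂.polytabloid ℂ hN₂ v) *
        (∑ w : Word n d, (∏ m, C (w m) (I m)) * T₃.polytabloid ℂ hN₃ w) with hS_def
  have hre : S = ∑ I : Fin d → Fin n,
      (∑ u : Word n d, (∏ m, A (u m) (I (τ m))) * T₁.polytabloid ℂ hN₁ u) *
        (∑ v : Word n d, (∏ m, B (v m) (I (τ m))) * T₂.polytabloid ℂ hN₂ v) *
        (∑ w : Word n d, (∏ m, C (w m) (I (τ m))) * T₃.polytabloid ℂ hN₃ w) := by
    rw [hS_def]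
    refine Fintype.sum_equiv (Equiv.arrowCongr τ (Equiv.refl (Fin n))) _ _ fun I => ?_
    have hI : ∀ m, ((Equiv.arrowCongr τ (Equiv.refl (Fin n))) I) (τ m) = I m := by
      intro m
      simp [Equiv.arrowCongr_apply]
    simp only [hI]
  have hneg : S = -S := by
    nth_rewrite 1 [hre]
    rw [hS_def, ← Finset.sum_neg_distrib]
    refine Finset.sum_congr rfl fun I _ => ?_
    rw [hτ_def, sum_prod_mul_polytabloid_comp_swap hN₁ T₁ hpq h₁ A I,
      sum_prod_mul_polytabloid_comp_swap hN₂ T₂ hpq h₂ B I,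
      sum_prod_mul_polytabloid_comp_swap hN₃ T₃ hpq h₃ C I]
    ring
  exact add_self_eq_zero.1 (by nth_rewrite 2 [hneg]; ring)

/-- **Designs of chromatic index `> n` die termwise** (BI 2013, Prop. 4.2: "`f_H(w) = 0` for all
tensors `w` satisfying `R̲(w) < χ'(H)`", in the extreme case `χ'(H) = d`): if every two distinct
positions share a column in at least one of `T₁, T₂, T₃` and `n < d`, then every
`I : [d] → [n]` identifies two positions (pigeonhole), these share a column of some `T_j`, and
that factor vanishes; so `∑_I ⟨⊗ a_I, e_{T₁}⟩ ⟨⊗ b_I, e_{T₂}⟩ ⟨⊗ c_I, e_{T₃}⟩ = 0`.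
[cite: BurgisserIkenmeyer2013, Prop. 4.2] -/
theorem tripleSum_eq_zero_of_forall_share (hN₁ : ∀ x ∈ Y₁.cells, x.1 < n)
    (hN₂ : ∀ x ∈ Y₂.cells, x.1 < n) (hN₃ : ∀ x ∈ Y₃.cells, x.1 < n) (T₁ : StdFilling d Y₁)
    (T₂ : StdFilling d Y₂) (T₃ : StdFilling d Y₃) (hnd : n < d)
    (hshare : ∀ p q : Fin d, p ≠ q →
      (T₁.1 p).2 = (T₁.1 q).2 ∨ (T₂.1 p).2 = (T₂.1 q).2 ∨ (T₃.1 p).2 = (T₃.1 q).2)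
    (A B C : Matrix (Fin n) (Fin n) ℂ) :
    ∑ I : Fin d → Fin n, (∑ u : Word n d, (∏ m, A (u m) (I m)) * T₁.polytabloid ℂ hN₁ u) *
        (∑ v : Word n d, (∏ m, B (v m) (I m)) * T₂.polytabloid ℂ hN₂ v) *
        (∑ w : Word n d, (∏ m, C (w m) (I m)) * T₃.polytabloid ℂ hN₃ w) = 0 := by
  refine Finset.sum_eq_zero fun I _ => ?_
  obtain ⟨p, q, hpq, hI⟩ := Fintype.exists_ne_map_eq_of_card_lt I (by simpa using hnd)
  rcases hshare p q hpq with h | h | h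
  · rw [sum_prod_mul_polytabloid_eq_zero_of_apply_eq hN₁ T₁ hpq h A hI, zero_mul, zero_mul]
  · rw [sum_prod_mul_polytabloid_eq_zero_of_apply_eq hN₂ T₂ hpq h B hI, mul_zero, zero_mul]
  · rw [sum_prod_mul_polytabloid_eq_zero_of_apply_eq hN₃ T₃ hpq h C hI, mul_zero]

end Triples

/-! ## §4 The hook diagram of `λ(κ)` and the uniqueness of the obstruction design `H_κ` -/

section Hook

variable {κ : ℕ}

/-- The sorted parts of the hook partition `(κ+1, 1^{2κ}) ⊢ 3κ+1` are `κ+1, 1, …, 1`.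
[cite: BurgisserIkenmeyer2013, §4.4 (before Lemma 4.4)] -/
theorem sortedParts_bi2013Hook (κ : ℕ) :
    (bi2013Hook κ).sortedParts = (κ + 1) :: List.replicate (2 * κ) 1 := by
  have hperm : (bi2013Hook κ).sortedParts.Perm ((κ + 1) :: List.replicate (2 * κ) 1) := by
    rw [← Multiset.coe_eq_coe, Nat.Partition.sortedParts, Multiset.sort_eq, bi2013Hook_parts,
      ← Multiset.cons_coe, Multiset.coe_replicate, Multiset.singleton_add]
  refine hperm.eq_of_sortedGE (bi2013Hook κ).sortedGE_sortedParts ?_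
  refine List.Pairwise.sortedGE (List.pairwise_cons.2 ⟨fun b hb => ?_, ?_⟩)
  · rw [List.eq_of_mem_replicate hb]
    omega
  · exact List.pairwise_replicate.2 (Or.inr le_rfl)

/-- The cells of the hook diagram: row `0` has the `κ + 1` cells `(0, c)`, `c ≤ κ`, and rows
`1, …, 2κ` have the single cell `(r, 0)`. [cite: BurgisserIkenmeyer2013, §4.4 (before Lemma 4.4)] -/
theorem mem_youngDiagram_bi2013Hook {x : ℕ × ℕ} :
    x ∈ (bi2013Hook κ).youngDiagram ↔
      (x.1 = 0 ∧ x.2 < κ + 1) ∨ (0 < x.1 ∧ x.1 < 2 * κ + 1 ∧ x.2 = 0) := by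
  rw [Nat.Partition.mem_youngDiagram_iff, sortedParts_bi2013Hook]
  obtain ⟨r, c⟩ := x
  rcases r with _ | r
  · simp
  · simp only [List.length_cons, List.length_replicate, List.getElem_cons_succ,
      List.getElem_replicate, Nat.lt_one_iff, Nat.succ_pos', true_and]
    constructor
    · rintro ⟨h, hc⟩
      exact Or.inr ⟨h, hc⟩
    · rintro (⟨h, _⟩ | ⟨h, hc⟩)
      · exact absurd h (Nat.succ_ne_zero r)
      · exact ⟨h, hc⟩

/-- Every cell of the hook diagram lies in a column `< κ + 1`.
[cite: BurgisserIkenmeyer2013, §4.4 (before Lemma 4.4)] -/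
theorem snd_lt_of_mem_youngDiagram_bi2013Hook {x : ℕ × ℕ} (hx : x ∈ (bi2013Hook κ).youngDiagram) :
    x.2 < κ + 1 := by
  rcases mem_youngDiagram_bi2013Hook.1 hx with ⟨_, h⟩ | ⟨_, _, h⟩
  · exact h
  · rw [h]
    exact Nat.succ_pos κ

/-- The first column of the hook diagram has the `2κ + 1` cells `(r, 0)`, `r < 2κ + 1`.
[cite: BurgisserIkenmeyer2013, §4.4 (before Lemma 4.4)] -/
theorem mk_zero_mem_youngDiagram_bi2013Hook {r : ℕ} (hr : r < 2 * κ + 1) :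
    (r, 0) ∈ (bi2013Hook κ).youngDiagram := by
  rw [mem_youngDiagram_bi2013Hook]
  rcases Nat.eq_zero_or_pos r with h | h
  · exact Or.inl ⟨h, Nat.succ_pos κ⟩
  · exact Or.inr ⟨h, hr, rfl⟩

/-- A standard tableau of hook shape `(κ+1, 1^{2κ})` has at least `2κ + 1` entries in its first
column (one for each cell `(r, 0)`). [cite: BurgisserIkenmeyer2013, §4.4 (before Lemma 4.4)] -/
theorem le_card_filter_snd_eq_zero (T : StdFilling (3 * κ + 1) (bi2013Hook κ).youngDiagram) :
    2 * κ + 1 ≤ (Finset.univ.filter fun p => (T.1 p).2 = 0).card := by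
  classical
  have hd : (bi2013Hook κ).youngDiagram.cells.card = 3 * κ + 1 :=
    Nat.Partition.card_cells_youngDiagram _
  have hex : ∀ r ∈ Finset.range (2 * κ + 1), ∃ p : Fin (3 * κ + 1), T.1 p = (r, 0) := fun r hr =>
    T.exists_eq hd (mk_zero_mem_youngDiagram_bi2013Hook (Finset.mem_range.1 hr))
  choose! g hg using hex
  calc 2 * κ + 1 = (Finset.range (2 * κ + 1)).card := (Finset.card_range _).symm
    _ ≤ (Finset.univ.filter fun p => (T.1 p).2 = 0).card := by
      refine Finset.card_le_card_of_injOn g (fun r hr => ?_) (fun r₁ hr₁ r₂ hr₂ h => ?_)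
      · simp only [Finset.coe_filter, Finset.mem_univ, true_and, Set.mem_setOf_eq, hg r hr]
      · have h₁ := hg r₁ hr₁
        rw [h, hg r₂ hr₂] at h₁
        exact (Prod.mk.inj h₁).1.symm

/-- **The counting behind "One can prove that `H_κ` is the only obstruction design of type
`λ(κ)`"** (BI 2013, Rem. 4.7). Let `T_a, T_b, T_c` be standard tableaux of the hook shape on the
same `3κ + 1` positions such that no two distinct positions lie in one column of all three. Then
a position outside the first column of `T_b` lies in the first column of `T_a`: on the positions
common to the first columns of `T_a` and `T_b` the column of `T_c` is injective with `≤ κ + 1`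
values, the first columns have `≥ 2κ + 1` entries and their complements `≤ κ`.
[cite: BurgisserIkenmeyer2013, Rem. 4.7] -/
theorem snd_eq_zero_of_snd_ne_zero (Ta Tb Tc : StdFilling (3 * κ + 1) (bi2013Hook κ).youngDiagram)
    (hinj : ∀ p q : Fin (3 * κ + 1), p ≠ q → (Ta.1 p).2 = (Ta.1 q).2 → (Tb.1 p).2 = (Tb.1 q).2 →
      (Tc.1 p).2 ≠ (Tc.1 q).2)
    {p : Fin (3 * κ + 1)} (hpb : (Tb.1 p).2 ≠ 0) : (Ta.1 p).2 = 0 := by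
  classical
  by_contra hpa
  set Za := (Finset.univ.filter fun x : Fin (3 * κ + 1) => (Ta.1 x).2 = 0) with hZa_def
  set Zb := (Finset.univ.filter fun x : Fin (3 * κ + 1) => (Tb.1 x).2 = 0) with hZb_def
  have hZa : 2 * κ + 1 ≤ Za.card := le_card_filter_snd_eq_zero Ta
  have hZb : 2 * κ + 1 ≤ Zb.card := le_card_filter_snd_eq_zero Tb
  have hint : (Za ∩ Zb).card ≤ κ + 1 := by
    calc (Za ∩ Zb).card ≤ (Finset.range (κ + 1)).card := by
          refine Finset.card_le_card_of_injOn (fun x => (Tc.1 x).2) (fun x _ => ?_)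
            (fun x hx y hy hxy => ?_)
          · simp only [Finset.coe_range, Set.mem_Iio]
            exact snd_lt_of_mem_youngDiagram_bi2013Hook (Tc.mem x)
          · simp only [Finset.coe_inter, Finset.coe_filter, Finset.mem_univ, true_and,
              Set.mem_inter_iff, Set.mem_setOf_eq, hZa_def, hZb_def] at hx hy
            by_contra hne
            exact hinj x y hne (hx.1.trans hy.1.symm) (hx.2.trans hy.2.symm) hxy
      _ = κ + 1 := Finset.card_range _
  have hpZb : p ∈ Zbᶜ := by
    rw [Finset.mem_compl, hZb_def, Finset.mem_filter]
    exact fun h => hpb h.2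
  have hpZa : p ∉ Za := by
    rw [hZa_def, Finset.mem_filter]
    exact fun h => hpa h.2
  have hsub : Za ⊆ (Za ∩ Zb) ∪ (Zbᶜ).erase p := by
    intro x hx
    by_cases hxb : x ∈ Zb
    · exact Finset.mem_union.2 (Or.inl (Finset.mem_inter.2 ⟨hx, hxb⟩))
    · refine Finset.mem_union.2 (Or.inr (Finset.mem_erase.2 ⟨?_, Finset.mem_compl.2 hxb⟩))
      rintro rfl
      exact hpZa hx
  have hcb : (Zbᶜ).card ≤ κ := by
    rw [Finset.card_compl, Fintype.card_fin]
    omega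
  have hcb1 : 1 ≤ (Zbᶜ).card := Finset.card_pos.2 ⟨p, hpZb⟩
  have herase : ((Zbᶜ).erase p).card = (Zbᶜ).card - 1 := Finset.card_erase_of_mem hpZb
  have hle := (Finset.card_le_card hsub).trans (Finset.card_union_le _ _)
  omega

/-- **`H_κ` is the only obstruction design of type `λ(κ)`** (BI 2013, Rem. 4.7: "One can prove
that `H_κ` is the only obstruction design of type `λ(κ)`"), in the form used: if three standard
tableaux of hook shape `(κ+1, 1^{2κ})` on the same `3κ + 1` positions place no two distinct
positions in a common column of all three (i.e. the positions form an obstruction design of type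
`λ(κ)`), then every two distinct positions share the first column of at least one of them — the
design is the "3-dimensional hook", of chromatic index `3κ + 1`.
[cite: BurgisserIkenmeyer2013, Rem. 4.7 (with §4.4)] -/
theorem share_column_of_design (T₁ T₂ T₃ : StdFilling (3 * κ + 1) (bi2013Hook κ).youngDiagram)
    (hinj : ∀ p q : Fin (3 * κ + 1), p ≠ q →
      (T₁.1 p).2 ≠ (T₁.1 q).2 ∨ (T₂.1 p).2 ≠ (T₂.1 q).2 ∨ (T₃.1 p).2 ≠ (T₃.1 q).2)
    (p q : Fin (3 * κ + 1)) :
    (T₁.1 p).2 = (T₁.1 q).2 ∨ (T₂.1 p).2 = (T₂.1 q).2 ∨ (T₃.1 p).2 = (T₃.1 q).2 := by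
  have h21 : ∀ x, (T₁.1 x).2 ≠ 0 → (T₂.1 x).2 = 0 := fun x hx =>
    snd_eq_zero_of_snd_ne_zero T₂ T₁ T₃ (fun p q hpq h2 h1 => by
      rcases hinj p q hpq with h | h | h
      · exact absurd h1 h
      · exact absurd h2 h
      · exact h) hx
  have h31 : ∀ x, (T₁.1 x).2 ≠ 0 → (T₃.1 x).2 = 0 := fun x hx =>
    snd_eq_zero_of_snd_ne_zero T₃ T₁ T₂ (fun p q hpq h3 h1 => by
      rcases hinj p q hpq with h | h | h
      · exact absurd h1 h
      · exact h
      · exact absurd h3 h) hx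
  have h32 : ∀ x, (T₂.1 x).2 ≠ 0 → (T₃.1 x).2 = 0 := fun x hx =>
    snd_eq_zero_of_snd_ne_zero T₃ T₂ T₁ (fun p q hpq h3 h2 => by
      rcases hinj p q hpq with h | h | h
      · exact h
      · exact absurd h2 h
      · exact absurd h3 h) hx
  by_cases h1p : (T₁.1 p).2 = 0
  · by_cases h1q : (T₁.1 q).2 = 0
    · exact Or.inl (h1p.trans h1q.symm)
    · by_cases h2p : (T₂.1 p).2 = 0
      · exact Or.inr (Or.inl (h2p.trans (h21 q h1q).symm))
      · exact Or.inr (Or.inr ((h32 p h2p).trans (h31 q h1q).symm))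
  · by_cases h2q : (T₂.1 q).2 = 0
    · exact Or.inr (Or.inl ((h21 p h1p).trans h2q.symm))
    · exact Or.inr (Or.inr ((h31 p h1p).trans (h32 q h2q).symm))

/-- **`f_H` vanishes termwise for every triple of hook tableaux** (the two mechanisms of §3
combined with the uniqueness of the design): for `n = 3κ < d = 3κ + 1`, any three
standard tableaux `T₁, T₂, T₃` of shape `λ(κ)` and any `n × n` matrices `A, B, C`,
`∑_{I : [d] → [n]} ⟨⊗ a_I, e_{T₁}⟩ ⟨⊗ b_I, e_{T₂}⟩ ⟨⊗ c_I, e_{T₃}⟩ = 0`.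
[cite: BurgisserIkenmeyer2013, Rem. 4.7 (with Prop. 4.2)] -/
theorem hook_tripleSum_eq_zero (hN : ∀ x ∈ (bi2013Hook κ).youngDiagram.cells, x.1 < 3 * κ)
    (T₁ T₂ T₃ : StdFilling (3 * κ + 1) (bi2013Hook κ).youngDiagram)
    (A B C : Matrix (Fin (3 * κ)) (Fin (3 * κ)) ℂ) :
    ∑ I : Fin (3 * κ + 1) → Fin (3 * κ),
      (∑ u : Word (3 * κ) (3 * κ + 1), (∏ m, A (u m) (I m)) * T₁.polytabloid ℂ hN u) *
        (∑ v : Word (3 * κ) (3 * κ + 1), (∏ m, B (v m) (I m)) * T₂.polytabloid ℂ hN v) *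
        (∑ w : Word (3 * κ) (3 * κ + 1), (∏ m, C (w m) (I m)) * T₃.polytabloid ℂ hN w) = 0 := by
  by_cases h : ∀ p q : Fin (3 * κ + 1), p ≠ q →
      (T₁.1 p).2 ≠ (T₁.1 q).2 ∨ (T₂.1 p).2 ≠ (T₂.1 q).2 ∨ (T₃.1 p).2 ≠ (T₃.1 q).2
  · exact tripleSum_eq_zero_of_forall_share hN hN hN T₁ T₂ T₃ (by omega)
      (fun p q _ => share_column_of_design T₁ T₂ T₃ h p q) A B C
  · push Not at h
    obtain ⟨p, q, hpq, h₁, h₂, h₃⟩ := h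
    exact tripleSum_eq_zero_of_common_column hN hN hN T₁ T₂ T₃ hpq h₁ h₂ h₃ A B C

end Hook

/-! ## §5 The vanishing half of Rem. 4.7: `mult_{λ(κ)}(ℂ[closure(GL³·⟨3κ⟩)]_{3κ+1}) = 0` -/

section Main

variable {κ : ℕ}

/-- Expanding a highest-weight vector in polytabloids inside an elementary pairing:
`⟨⊗ x_I, ∑_T a_T e_T⟩ = ∑_T a_T ⟨⊗ x_I, e_T⟩`. [cite: BurgisserIkenmeyerPanovaJAMS2019, Prop. 3.3] -/
theorem sum_prod_mul_sum_smul_polytabloid {n d : ℕ} {Y : YoungDiagram} (hN : ∀ x ∈ Y.cells, x.1 < n)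
    (M : Matrix (Fin n) (Fin n) ℂ) (I : Fin d → Fin n) (a : StdFilling d Y → ℂ) :
    ∑ u : Word n d, (∏ m, M (u m) (I m)) * (∑ T, a T • T.polytabloid ℂ hN) u =
      ∑ T, a T * ∑ u : Word n d, (∏ m, M (u m) (I m)) * T.polytabloid ℂ hN u := by
  simp only [Finset.sum_apply, Pi.smul_apply, smul_eq_mul, Finset.mul_sum]
  rw [Finset.sum_comm]
  refine Finset.sum_congr rfl fun T _ => Finset.sum_congr rfl fun u _ => ?_
  ring

/-- **All pairings of `⟨3κ⟩^{⊗(3κ+1)}` with highest-weight vectors of weight `λ(κ)` vanish.** For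
`κ ≥ 1`, every three `3κ × 3κ` matrices `A, B, C` and every three coefficient vectors on the
standard tableaux of hook shape `(κ+1, 1^{2κ})`:
`⟪((A⊗B⊗C)·⟨3κ⟩)^{⊗(3κ+1)}, ξ₁ ⊗ ξ₂ ⊗ ξ₃⟫ = 0` for `ξ_j = ∑_T a_j(T) e_T` — i.e. (tree
`highestWeightSpace_wordRep_eq_span_polytabloid` = BI 2013 Thm. 4.1's span statement, one factor
at a time) for ALL highest-weight vectors of these weights: "Proposition 4.2 implies that
`f_{H_κ}` vanishes on closure(`GL_n³ E_n`)" together with "`H_κ` is the only obstruction design of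
type `λ(κ)`". [cite: BurgisserIkenmeyer2013, Rem. 4.7 (with Prop. 4.2 and Thm. 4.1)] -/
theorem pairing_unitTensor_hook_eq_zero (hN : ∀ x ∈ (bi2013Hook κ).youngDiagram.cells, x.1 < 3 * κ)
    (A B C : Matrix (Fin (3 * κ)) (Fin (3 * κ)) ℂ)
    (a₁ a₂ a₃ : StdFilling (3 * κ + 1) (bi2013Hook κ).youngDiagram → ℂ) :
    ∑ u, ∑ v, ∑ w, kroneckerPow (actTensor A B C (unitTensor ℂ (3 * κ))) (3 * κ + 1) u v w *
      triad (∑ T, a₁ T • T.polytabloid ℂ hN) (∑ T, a₂ T • T.polytabloid ℂ hN)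
        (∑ T, a₃ T • T.polytabloid ℂ hN) u v w = 0 := by
  rw [pairing_unitTensor_eq_sum]
  simp only [sum_prod_mul_sum_smul_polytabloid]
  -- abbreviations for the elementary pairings
  set P₁ : (Fin (3 * κ + 1) → Fin (3 * κ)) → StdFilling (3 * κ + 1) (bi2013Hook κ).youngDiagram → ℂ :=
    fun I T => ∑ u : Word (3 * κ) (3 * κ + 1), (∏ m, A (u m) (I m)) * T.polytabloid ℂ hN u
    with hP₁
  set P₂ : (Fin (3 * κ + 1) → Fin (3 * κ)) → StdFilling (3 * κ + 1) (bi2013Hook κ).youngDiagram → ℂ :=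
    fun I T => ∑ v : Word (3 * κ) (3 * κ + 1), (∏ m, B (v m) (I m)) * T.polytabloid ℂ hN v
    with hP₂
  set P₃ : (Fin (3 * κ + 1) → Fin (3 * κ)) → StdFilling (3 * κ + 1) (bi2013Hook κ).youngDiagram → ℂ :=
    fun I T => ∑ w : Word (3 * κ) (3 * κ + 1), (∏ m, C (w m) (I m)) * T.polytabloid ℂ hN w
    with hP₃
  have hexp : ∀ I : Fin (3 * κ + 1) → Fin (3 * κ),
      (∑ T, a₁ T * P₁ I T) * (∑ T, a₂ T * P₂ I T) * (∑ T, a₃ T * P₃ I T) =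
        ∑ T₁, ∑ T₂, ∑ T₃, (a₁ T₁ * a₂ T₂ * a₃ T₃) * (P₁ I T₁ * P₂ I T₂ * P₃ I T₃) := by
    intro I
    rw [Finset.sum_mul_sum, Finset.sum_mul]
    refine Finset.sum_congr rfl fun T₁ _ => ?_
    rw [Finset.sum_mul]
    refine Finset.sum_congr rfl fun T₂ _ => ?_
    rw [Finset.mul_sum]
    refine Finset.sum_congr rfl fun T₃ _ => ?_
    ring
  change ∑ I, (∑ T, a₁ T * P₁ I T) * (∑ T, a₂ T * P₂ I T) * (∑ T, a₃ T * P₃ I T) = 0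
  rw [Finset.sum_congr rfl fun I _ => hexp I, sum_comm₄]
  refine Finset.sum_eq_zero fun T₁ _ => Finset.sum_eq_zero fun T₂ _ =>
    Finset.sum_eq_zero fun T₃ _ => ?_
  rw [← Finset.mul_sum, hP₁, hP₂, hP₃, hook_tripleSum_eq_zero hN T₁ T₂ T₃ A B C, mul_zero]

/-- **Bürgisser–Ikenmeyer 2013, Rem. 4.7 — the vanishing half, PROVED for every `κ ≥ 1`:**
"Put `n := 3κ` and `d := 3κ+1`. Proposition 4.2 implies that `f_{H_κ}` vanishes on
`closure(GL_n³ E_n)`. Therefore, `mult_{λ(κ)}(ℂ[closure(GL_n³ E_n)]_d) = 0`." In the tree's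
occurrence vocabulary (module docstring of `MatMulOccurrenceObstructions.lean`): the triple isotypic
character sum of type `λ(κ) = (hook, hook, hook)`, `hook = (κ+1, 1^{2κ}) = bi2013Hook κ`, KILLS the
`(3κ+1)`-st tensor power of the unit tensor `⟨3κ⟩` — type `λ(κ)` does not occur in degree `3κ+1`
of the coordinate ring of the tensors of border rank `≤ 3κ`. Proof: occurrence would give a
non-vanishing pairing with a translate of a triple of highest-weight vectors
(`exists_pairing_ne_zero_of_isotypicSum₁₂₃_kroneckerPow_ne_zero`); these are combinations of
polytabloids (`exists_sum_smul_polytabloid_eq`), and all such pairings vanish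
(`pairing_unitTensor_hook_eq_zero`). This is the first conjunct of the named fact
`burgisserIkenmeyer2013_rem_4_7` (there under `2κ + 1 = m²`, `m ≥ 3` odd, so `κ ≥ 4`).
[cite: BurgisserIkenmeyer2013, Rem. 4.7 (with Prop. 4.2 and Thm. 4.1)] -/
theorem isotypicSum_bi2013Hook_kroneckerPow_unitTensor_eq_zero (κ : ℕ) (hκ : 1 ≤ κ) :
    isotypicSum₁ (bi2013Hook κ) (isotypicSum₂ (bi2013Hook κ) (isotypicSum₃ (bi2013Hook κ)
      (kroneckerPow (unitTensor ℂ (3 * κ)) (3 * κ + 1)))) = 0 := by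
  by_contra hne
  obtain ⟨A, B, C, ξ₁, ξ₂, ξ₃, h₁, h₂, h₃, hP⟩ :=
    exists_pairing_ne_zero_of_isotypicSum₁₂₃_kroneckerPow_ne_zero
      (lam := fun _ : Fin 3 => bi2013Hook κ) hne
  have hN : ∀ x ∈ (bi2013Hook κ).youngDiagram.cells, x.1 < 3 * κ := fun x hx =>
    fst_lt_of_mem_youngDiagram (bi2013Hook κ) (by rw [card_parts_bi2013Hook]; omega) hx
  have hd : (bi2013Hook κ).youngDiagram.cells.card = 3 * κ + 1 :=
    Nat.Partition.card_cells_youngDiagram _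
  simp only [← ydWeight_youngDiagram] at h₁ h₂ h₃
  obtain ⟨a₁, rfl⟩ := exists_sum_smul_polytabloid_eq hN hd h₁
  obtain ⟨a₂, rfl⟩ := exists_sum_smul_polytabloid_eq hN hd h₂
  obtain ⟨a₃, rfl⟩ := exists_sum_smul_polytabloid_eq hN hd h₃
  exact hP (pairing_unitTensor_hook_eq_zero hN A B C a₁ a₂ a₃)

/-- **What remains of the named fact `burgisserIkenmeyer2013_rem_4_7`.** With the vanishing half
proved for every `κ ≥ 1`, the fact is EQUIVALENT to its matrix-multiplication half, i.e. to
Bürgisser–Ikenmeyer's Lemma 4.4 ("There exists a matrix triple `A ∈ (GL_{m²})³` such that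
`f_{H_κ}(A MaMu_m) ≠ 0`, where `κ := (m²−1)/2` for `m > 1` odd" — the occurrence of `λ(κ)` in
degree `3κ+1` for `⟨m,m,m⟩`), taken here as an explicit hypothesis and NOT discharged (its proof
is §6 of the paper, "the technically most involved part of this paper").
[cite: BurgisserIkenmeyer2013, Rem. 4.7 and Lemma 4.4] -/
theorem burgisserIkenmeyer2013_rem_4_7_of_lemma_4_4
    (h44 : ∀ (m κ : ℕ), Odd m → 3 ≤ m → 2 * κ + 1 = m ^ 2 →
      isotypicSum₁ (bi2013Hook κ) (isotypicSum₂ (bi2013Hook κ) (isotypicSum₃ (bi2013Hook κ)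
        (kroneckerPow (matMulTensor ℂ m m m) (3 * κ + 1)))) ≠ 0) :
    burgisserIkenmeyer2013_rem_4_7 := fun m κ hm h3 hκ =>
  ⟨isotypicSum_bi2013Hook_kroneckerPow_unitTensor_eq_zero κ (by nlinarith),
    h44 m κ hm h3 hκ⟩

/-- Conversely the named fact contains Lemma 4.4 in this form (so the reduction above loses
nothing). [cite: BurgisserIkenmeyer2013, Rem. 4.7 and Lemma 4.4] -/
theorem lemma_4_4_of_burgisserIkenmeyer2013_rem_4_7 (h : burgisserIkenmeyer2013_rem_4_7)
    (m κ : ℕ) (hm : Odd m) (h3 : 3 ≤ m) (hκ : 2 * κ + 1 = m ^ 2) :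
    isotypicSum₁ (bi2013Hook κ) (isotypicSum₂ (bi2013Hook κ) (isotypicSum₃ (bi2013Hook κ)
      (kroneckerPow (matMulTensor ℂ m m m) (3 * κ + 1)))) ≠ 0 :=
  (h m κ hm h3 hκ).2

end Main

end Literature.Computability.AlgebraicComplexity
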